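import Mathlib.Algebra.CharZero.Infinite
import Mathlib.Algebra.MvPolynomial.Funext
import Literature.Computability.AlgebraicComplexity.OrbitClosureWeights
import Literature.NumberTheory.DiophantineGeometry.SchurWeylPlethysm
import HarnessLib

/-!
# Highest weights of `k[Sym^m (k^N)]` are duals of partitions — discharge of
# `exists_eq_dualOfPartition_of_hasHighestWeight_coordRep`

The named fact
`Literature.NumberTheory.DiophantineGeometry.exists_eq_dualOfPartition_of_hasHighestWeight_coordRep`
of `SchurWeylPlethysm.lean` (BLMW 2011 §4.4 with (5.2.2)): in characteristic zero every highest
weight `χ` of G20's representation `coordRep (Fin N) k m` of `GL_N` on the coordinate ring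
`k[Sym^m (k^N)] = ⊕_n Sym^n (Sym^m k^N)^*` is `λ^* = Weight.dualOfPartition N λ` for a partition
`λ ⊢ n·m` with at most `N` parts.

Source, as printed (arXiv version of BLMW 2011, end of §4.4): "Consider the case `V = S^d W`,
then a `GL(W)`-module `S_π W` can only occur in `ℂ[\overline{GL(W)·v}]` if `|π| = δd` for some
`δ` and in that case it can only appear in `ℂ[\overline{GL(W)·v}]_δ ⊂ S^δ(S^d W^*) ⊂ Sym(S^d W^*)`";
the published version records the instance `v = det_n` as Prop. 5.2.1, (5.2.2)
(`ℂ[\overline{GL(W)·det_n}]_δ ⊆ ⊕_{|π| = nδ} (S_π W^*)^{⊕ k_{δ^n,δ^n,π}}`). The modules are written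
there up to the identification of `GL(W)`-modules with their duals; in this tree the coordinate
ring carries the duals `S_π(V)^*`, whose highest weights are the `Weight.dualOfPartition`
(module docstring of `SchurWeylPlethysm.lean`, §3).

## Proof

The tree already proves the statement ON EVERY ORBIT CLOSURE, over any infinite field and without
complete reducibility:
`Literature.Computability.AlgebraicComplexity.exists_eq_dualOfPartition_of_hasHighestWeight_orbitCoordRep`
(`OrbitClosureWeights.lean`; dominance by probing the `GL₂ ⊂ GL_N` at a pair `i < j`, nonpositivity
and size from the torus weights of monomials). The whole space `Sym^m (k^N)` is in general not an
orbit closure, but a single semi-invariant only sees one orbit: a nonzero `B`-semi-invariant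
`F ∈ k[Sym^m]` of weight `χ` does not vanish at some coefficient vector `a` (`k` is infinite,
`MvPolynomial.funext`), i.e. at the form `f_a = ∑_d a_d x^d` of degree `m`
(`formCoeff_sum_monomial`); hence `F ∉ I(GL · f_a)` (`not_mem_orbitVanishingIdeal_sum_monomial`),
and its class in `k[Δ_m[f_a]] = k[Sym^m] ⧸ I(GL · f_a)` is a nonzero `B`-semi-invariant of the
same weight, the quotient map being `GL`-equivariant (`mk_mem_highestWeightSpace_orbitCoordRep`;
this is the argument of `Literature.Computability.Complexity.hasHighestWeight_orbitCoordRep_of_not_mem`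
of `OccurrenceObstructionsBIP.lean`, restated in five lines to avoid that file's imports). So `χ`
is a highest weight of `k[Δ_m[f_a]]` (`exists_hasHighestWeight_orbitCoordRep_of_hasHighestWeight_coordRep`)
and the orbit theorem applies (with the identity enumeration of `Fin N`).

## References

* P. Bürgisser, J. M. Landsberg, L. Manivel, J. Weyman, *An overview of mathematical issues
  arising in the geometric complexity theory approach to VP ≠ VNP*, SIAM J. Comput. 40 (2011)
  1179–1209, §4.4, Prop. 5.2.1, (5.2.2) (= arXiv:0907.2850, §4.4 and Prop. 5.1)
  (key `BurgisserEtAl2011`).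
* W. Fulton, J. Harris, *Representation Theory*, GTM 129, §15.5, Ex. 15.50 (duals)
  (key `FultonHarrisGTM129`).
-/

namespace Literature.NumberTheory.DiophantineGeometry

open MvPolynomial

variable {k : Type*} [Field k]

/-! ### From the whole space `Sym^m (k^σ)` to the orbit of one form -/

section Reduction

variable {σ : Type*} [Fintype σ] [LinearOrder σ] {m : ℕ}

/-- The form `f_a = ∑_d a_d x^d` of degree `m` with prescribed coefficient vector `a` has
`formCoeff m f_a = a` (every point of the affine space `Sym^m (k^σ)` is the coefficient vector of
a form). Mulmuley–Sohoni 2001 §4 (`V = Sym^m`). [folklore] -/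
theorem formCoeff_sum_monomial (a : Literature.Computability.AlgebraicComplexity.DegIdx σ m → k) :
    Literature.Computability.AlgebraicComplexity.formCoeff m
        (∑ d : Literature.Computability.AlgebraicComplexity.DegIdx σ m, monomial d.1 (a d)) = a := by
  funext e
  rw [Literature.Computability.AlgebraicComplexity.formCoeff_apply, coeff_sum,
    Finset.sum_eq_single e]
  · rw [coeff_monomial, if_pos rfl]
  · intro d _ hd
    rw [coeff_monomial, if_neg fun h => hd (Subtype.ext h)]
  · intro h
    exact absurd (Finset.mem_univ e) h

/-- The form `f_a = ∑_d a_d x^d` is homogeneous of degree `m`. Mulmuley–Sohoni 2001 §4.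
[folklore] -/
theorem isHomogeneous_sum_monomial (a : Literature.Computability.AlgebraicComplexity.DegIdx σ m → k) :
    (∑ d : Literature.Computability.AlgebraicComplexity.DegIdx σ m,
      (monomial d.1 (a d) : MvPolynomial σ k)).IsHomogeneous m :=
  IsHomogeneous.sum _ _ _ fun d _ =>
    isHomogeneous_monomial _ (Literature.Computability.AlgebraicComplexity.mem_degMonomials_iff.mp d.2)

/-- A polynomial function `F` on `Sym^m (k^σ)` with `F(a) ≠ 0` does not lie in the vanishing
ideal `I(GL · f_a)` of the orbit of the form `f_a` with coefficient vector `a` (it does not vanish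
at the orbit point `f_a = 1 · f_a`). Mulmuley–Sohoni 2001 §4. [folklore] -/
theorem not_mem_orbitVanishingIdeal_sum_monomial
    {F : MvPolynomial (Literature.Computability.AlgebraicComplexity.DegIdx σ m) k}
    {a : Literature.Computability.AlgebraicComplexity.DegIdx σ m → k} (ha : aeval a F ≠ 0) :
    F ∉ Literature.Computability.AlgebraicComplexity.orbitVanishingIdeal
      (∑ d : Literature.Computability.AlgebraicComplexity.DegIdx σ m, monomial d.1 (a d)) m := by
  rw [Literature.Computability.AlgebraicComplexity.mem_orbitVanishingIdeal_iff]
  intro h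
  apply ha
  have h1 := h 1
  rwa [map_one, Module.End.one_apply, formCoeff_sum_monomial] at h1

/-- The quotient map `k[Sym^m] → k[Δ_m[f]] = k[Sym^m] ⧸ I(GL · f)` is `GL`-equivariant, so it
sends `B`-semi-invariants of weight `χ` of `coordRep σ k m` to `B`-semi-invariants of weight `χ`
of `orbitCoordRep f m` (the argument of
`Literature.Computability.Complexity.hasHighestWeight_orbitCoordRep_of_not_mem`, restated to keep
the imports of this file small). Mulmuley–Sohoni 2001 §5; BLMW 2011 §4.4. [folklore] -/
theorem mk_mem_highestWeightSpace_orbitCoordRep (f : MvPolynomial σ k) {χ : Weight σ}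
    {F : MvPolynomial (Literature.Computability.AlgebraicComplexity.DegIdx σ m) k}
    (hF : F ∈ highestWeightSpace (Literature.Computability.AlgebraicComplexity.coordRep σ k m) χ) :
    Ideal.Quotient.mk (Literature.Computability.AlgebraicComplexity.orbitVanishingIdeal f m) F ∈
      highestWeightSpace (Literature.Computability.AlgebraicComplexity.orbitCoordRep f m) χ := by
  intro b hb
  rw [Literature.Computability.AlgebraicComplexity.orbitCoordRep_apply,
    Literature.Computability.AlgebraicComplexity.orbitCoordSubst_mk,
    ← Literature.Computability.AlgebraicComplexity.coordRep_apply, hF b hb]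
  exact map_smul (Ideal.Quotient.mkₐ k
    (Literature.Computability.AlgebraicComplexity.orbitVanishingIdeal f m)) (weightChar χ b) F

/-- **A highest weight of `k[Sym^m (k^σ)]` is a highest weight of the coordinate ring of some
orbit closure.** Over an infinite field, if `χ` is a highest weight of `coordRep σ k m`, then
there is a form `f` of degree `m` such that `χ` is a highest weight of `k[Δ_m[f]]`
(`orbitCoordRep f m`): a nonzero semi-invariant `F` does not vanish at some form `f`
(`MvPolynomial.funext`), so its class in `k[Δ_m[f]]` is a nonzero semi-invariant of the same
weight. BLMW 2011 §4.4 (the coordinate ring of an orbit closure is the image of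
`Sym(V^*) = ℂ[V]`). [folklore] -/
theorem exists_hasHighestWeight_orbitCoordRep_of_hasHighestWeight_coordRep [Infinite k]
    {χ : Weight σ}
    (h : HasHighestWeight (Literature.Computability.AlgebraicComplexity.coordRep σ k m) χ) :
    ∃ f : MvPolynomial σ k, f.IsHomogeneous m ∧
      HasHighestWeight (Literature.Computability.AlgebraicComplexity.orbitCoordRep f m) χ := by
  obtain ⟨F, hF0, hF⟩ := (hasHighestWeight_iff_exists _ _).mp h
  obtain ⟨a, ha⟩ : ∃ a : Literature.Computability.AlgebraicComplexity.DegIdx σ m → k,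
      aeval a F ≠ 0 := by
    by_contra hall
    push Not at hall
    exact hF0 (MvPolynomial.funext fun a => by rw [map_zero]; exact hall a)
  refine ⟨∑ d : Literature.Computability.AlgebraicComplexity.DegIdx σ m, monomial d.1 (a d),
    isHomogeneous_sum_monomial a, ?_⟩
  rw [hasHighestWeight_iff_exists]
  exact ⟨Ideal.Quotient.mk _ F,
    fun h0 => not_mem_orbitVanishingIdeal_sum_monomial ha (Ideal.Quotient.eq_zero_iff_mem.mp h0),
    mk_mem_highestWeightSpace_orbitCoordRep _ hF⟩

end Reduction

/-! ### The discharge -/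

/-- **Discharge of `exists_eq_dualOfPartition_of_hasHighestWeight_coordRep`** (BLMW 2011 §4.4
with (5.2.2)): in characteristic zero, every highest weight of `k[Sym^m (k^N)]`
(`coordRep (Fin N) k m`) is `Weight.dualOfPartition N λ` for a partition `λ ⊢ n·m` with at most
`N` parts. Reduction to one orbit closure
(`exists_hasHighestWeight_orbitCoordRep_of_hasHighestWeight_coordRep`) and the orbit theorem
`Literature.Computability.AlgebraicComplexity.exists_eq_dualOfPartition_of_hasHighestWeight_orbitCoordRep`
(any infinite field; fields of characteristic zero are infinite).
[cite: BurgisserEtAl2011, §4.4 with (5.2.2)] -/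
theorem exists_eq_dualOfPartition_of_hasHighestWeight_coordRep_holds :
    exists_eq_dualOfPartition_of_hasHighestWeight_coordRep (k := k) := by
  intro _ N m χ h
  obtain ⟨f, -, hf⟩ := exists_hasHighestWeight_orbitCoordRep_of_hasHighestWeight_coordRep h
  obtain ⟨D, lam, hlamN, hlam⟩ :=
    Literature.Computability.AlgebraicComplexity.exists_eq_dualOfPartition_of_hasHighestWeight_orbitCoordRep
      (OrderIso.refl (Fin N)) f hf
  refine ⟨D, lam, hlamN, ?_⟩
  rw [hlam]
  rfl

end Literature.NumberTheory.DiophantineGeometry
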